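import Literature.Probability.Percolation.ArmSeparationExclusionInner
import Literature.Probability.Percolation.TrapFenceGen
import HarnessLib

/-!
# The raw good event of a term of the exploration sequence, and its failure bound

Topic `Literature/Probability/Percolation`; family `crit-perc` / near-critical percolation on `𝕋`.
A brick of the near-critical arm-separation theorem for four arms in the ADJACENT colour
arrangement (P. Nolin, EJP 13 (2008), Thm. 11, `j = 4`, `σ = BBWW` [arXiv 0711.4948: Thm. 10];
the last missing input `hsepAdj` of `Werner2009_lemma63_of_altSeparation_of_adjSeparation`).

The success events `TrapFenceOK`, `TrapFenceOK₂`, `TrapFenceOK₃` of the tree record the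
CONSEQUENCES of a good configuration off `lower c z` (a fence attached to `c`, protection, the two
exclusion rings). The rerouting of two arms of the SAME colour (Nolin 2008, §4.4, proof of
Lemma 15, last paragraph) needs the good configuration itself — the open frame — in order to
attach the fence to the first of `c ∪ (arms)` met along the frame (`trap_exists_fence_gen`). This
file therefore introduces the RAW success event and transfers the failure bound to it:

* `TrapRawOK M c z k ω` — some configuration agreeing with `ω` off `lower c z` lies in
  `trapRSW₃ z k` (open frames at scales `k`, `8k`; closed rings in `[17k,31k]` and `[3k,7k]`);
  `TrapRawOK.fenceOK₃` (it implies `TrapFenceOK₃`), `TrapRawOK.exists_fence_gen` (the fence with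
  any stopping set `S ⊇ c` inside `Λ_{2M}`), `TrapRawOK.no_escape` (protection),
  `TrapRawOK.outer_ring`, `TrapRawOK.inner_ring` (the exclusions);
* `TrapSeqFailRaw M u k₀ K ω` — the `u`-th term exists and is raw-bad on all scales;
  `trapNoRSW₃_of_failRaw`; `real_trapSeqFailRaw_le_at` — at density `p`,
  `P_p(TrapSeqFailRaw) ≤ P_p(term u exists) · (1 - c_F² c_E c_I)^K` (the proof of
  `real_trapSeqFail₃_le_at` verbatim: that proof only used the raw event).

Everything here is proved; no named facts are introduced.

## References

* P. Nolin, Near-critical percolation in two dimensions, *Electron. J. Probab.* 13 (2008), §4.4,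
  proof of Lemma 15 (arXiv 0711.4948: Lemma 14) [Nolin2008].
* H. Kesten, Scaling relations for 2D-percolation, *Comm. Math. Phys.* 109 (1987), Lemma 2
  [Kesten1987].

Tree: `trapRSW₃`, `TrapFenceOK₃`, `trapFenceOK₃_of_mem_trapRSW₃`, `TrapNoRSW₃`,
`determinedBy_trapNoRSW₃`, `trapNoRSW₃_subset`, `real_iInter_compl_trapRSW₃_le_at`,
`not_pathIn_of_closed_innerRing` (`ArmSeparationExclusionInner.lean`); `not_pathIn_of_closed_ring`
(`ArmSeparationExclusion.lean`); `trap_no_closed_escape` (`ArmSeparationFrame.lean`);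
`trap_exists_fence_gen` (`TrapFenceGen.lean`); `JDomain.determinedBy_lowestSeq_eq`,
`sitePercolation_real_inter_of_disjoint`, `trapPairs`.
-/

noncomputable section

open MeasureTheory ProbabilityTheory Set

namespace Literature.Probability.Percolation

open LatticeModels

/-! ### The raw success event of a term -/

/-- **Raw success of the fence of `c` (tip `z`) at scale `k`**: some configuration agreeing with
`ω` off `lower c z` lies in `trapRSW₃ z k`. [cite: Nolin2008, §4.4 Lemma 15 (proof) (arXiv 0711.4948: Lemma 14)] -/
def TrapRawOK (M : ℕ) (c : Finset (Site 2)) (z : Site 2) (k : ℕ) (ω : SiteConfig (Site 2)) : Prop :=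
  ∃ ω' : SiteConfig (Site 2), (∀ v, v ∉ (trapDomain M).lower c z → (v ∈ ω' ↔ v ∈ ω)) ∧ ω' ∈ trapRSW₃ z k

namespace TrapRawOK

variable {M k : ℕ} {c : Finset (Site 2)} {z : Site 2} {ω : SiteConfig (Site 2)}

/-- Raw success implies the packaged success `TrapFenceOK₃` (`1 ≤ k`, `16k + 1 ≤ M`, `c` an open
crossing). [cite: Nolin2008, §4.4 Lemma 15 (proof) (arXiv 0711.4948: Lemma 14)] -/
theorem fenceOK₃ (h : TrapRawOK M c z k ω) (hk : 1 ≤ k) (hkM : 16 * (k : ℤ) + 1 ≤ M)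
    (hc : (trapDomain M).IsCrossing c z) (hcω : (↑c : Set (Site 2)) ⊆ ω) : TrapFenceOK₃ M c z k ω := by
  obtain ⟨ω', hagree, hω'⟩ := h
  exact trapFenceOK₃_of_mem_trapRSW₃ hk hkM hc hcω hagree hω'

/-- **The fence with a stopping set** from raw success: for every set `S` of sites of `Λ_{2M}`
containing `c`, an open vertical crossing of the corner box through a site `m`, a site `q ∈ S`, a
neighbour `p` of `q`, and an open `S`-avoiding path from `p` to `m` in the fence zone whose inside
sites are above `c` and whose outside sites are above the row of `z` (`1 ≤ k`, `2k + 1 ≤ M`). [cite: Nolin2008, §4.4 Lemma 15 (proof) (arXiv 0711.4948: Lemma 14)] [cite: Kesten1987, Lemma 2] -/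
theorem exists_fence_gen (h : TrapRawOK M c z k ω) (hk : 1 ≤ k) (hkM : 2 * (k : ℤ) + 1 ≤ M)
    (hc : (trapDomain M).IsCrossing c z) {S : Set (Site 2)} (hcS : (↑c : Set (Site 2)) ⊆ S)
    (hSn : ∀ v ∈ S, triNorm v ≤ 2 * M) :
    ∃ m : Site 2, OpenVCrossThrough (triStrip (z 0 + k) (z 1 + k) k k) (z 1 + k) (z 1 + 2 * k) ω m ∧
      ∃ q ∈ S, ∃ p : Site 2, triGraph.Adj q p ∧
        PathIn triGraph ((trapFrameZone M z k ∩
          {v | (triNorm v ≤ 2 * M → v ∈ (trapDomain M).above c z) ∧ (2 * (M : ℤ) < triNorm v → z 1 < v 1)}) ∩ ω ∩ Sᶜ) p m := by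
  obtain ⟨ω', hagree, hω'⟩ := h
  exact trap_exists_fence_gen hk hkM hc hagree hω'.1.1.1 hcS hSn

/-- **Protection** from raw success: no closed path of the trapezoid from a top-type boundary site
in the `8k`-box about `z` to outside the `16k`-box (`1 ≤ k`, `c` open). [cite: Nolin2008, §4.4 Lemma 15 (proof) (arXiv 0711.4948: Lemma 14)] -/
theorem no_escape (h : TrapRawOK M c z k ω) (hk : 1 ≤ k) (hc : (trapDomain M).IsCrossing c z)
    (hcω : (↑c : Set (Site 2)) ⊆ ω) {q t : Site 2} (hq : q ∈ (trapDomain M).Tp ∪ (trapDomain M).Jabove z)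
    (hqin : z 0 - 8 * k ≤ q 0 ∧ q 0 ≤ z 0 + 8 * k ∧ z 1 - 8 * k ≤ q 1 ∧ q 1 ≤ z 1 + 8 * k)
    (ht : t 0 ≤ z 0 - 16 * k ∨ z 0 + 16 * k ≤ t 0 ∨ t 1 ≤ z 1 - 16 * k ∨ z 1 + 16 * k ≤ t 1) :
    ¬ PathIn triGraph ((↑(trapD M) : Set (Site 2)) ∩ ωᶜ) q t := by
  obtain ⟨ω', hagree, hω'⟩ := h
  intro hpath
  refine trap_no_closed_escape (k := 8 * k) (by omega) hc hcω hagree hω'.1.1.2 hq ?_ ?_ hpath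
  · push_cast; omega
  · push_cast; omega

/-- **Outer exclusion** from raw success: no open path off `lower c z` from the `17k`-box about
`z` to outside the `31k`-box (`1 ≤ k`). [cite: Nolin2008, §4.4 Lemma 15 (proof) (arXiv 0711.4948: Lemma 14)] -/
theorem outer_ring (h : TrapRawOK M c z k ω) (hk : 1 ≤ k) {s t : Site 2}
    (hs : z 0 - 17 * k ≤ s 0 ∧ s 0 ≤ z 0 + 17 * k ∧ z 1 - 17 * k ≤ s 1 ∧ s 1 ≤ z 1 + 17 * k)
    (ht : t 0 ≤ z 0 - 31 * k ∨ z 0 + 31 * k ≤ t 0 ∨ t 1 ≤ z 1 - 31 * k ∨ z 1 + 31 * k ≤ t 1) :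
    ¬ PathIn triGraph ((↑((trapDomain M).lower c z) : Set (Site 2))ᶜ ∩ ω) s t := by
  obtain ⟨ω', hagree, hω'⟩ := h
  refine not_pathIn_of_closed_ring hk (L := ↑((trapDomain M).lower c z)) (fun v hv => hagree v ?_) ?_ subset_rfl hs ht
  · exact fun h => hv (Finset.mem_coe.2 h)
  · have : ω'ᶜ ∈ triRingAt z k := hω'.1.2
    exact this

/-- **Inner exclusion** from raw success: no open path off `lower c z` from the `3k`-box about
`z` to outside the `7k`-box (`1 ≤ k`). [cite: Nolin2008, §4.4 Lemma 15 (proof) (arXiv 0711.4948: Lemma 14)] -/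
theorem inner_ring (h : TrapRawOK M c z k ω) (hk : 1 ≤ k) {s t : Site 2}
    (hs : z 0 - 3 * k ≤ s 0 ∧ s 0 ≤ z 0 + 3 * k ∧ z 1 - 3 * k ≤ s 1 ∧ s 1 ≤ z 1 + 3 * k)
    (ht : t 0 ≤ z 0 - 7 * k ∨ z 0 + 7 * k ≤ t 0 ∨ t 1 ≤ z 1 - 7 * k ∨ z 1 + 7 * k ≤ t 1) :
    ¬ PathIn triGraph ((↑((trapDomain M).lower c z) : Set (Site 2))ᶜ ∩ ω) s t := by
  obtain ⟨ω', hagree, hω'⟩ := h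
  refine not_pathIn_of_closed_innerRing hk (L := ↑((trapDomain M).lower c z)) (fun v hv => hagree v ?_) ?_ subset_rfl hs ht
  · exact fun h => hv (Finset.mem_coe.2 h)
  · have : ω'ᶜ ∈ triInnerRingAt z k := hω'.2
    exact this

/-- Off `lower c z`, a path avoiding `lower c z` is the same as a path in the complement; a
convenient reformulation of the exclusions for open sets `A` known to avoid `lower c z`. [folklore] -/
theorem not_pathIn_of_subset (h : TrapRawOK M c z k ω) (hk : 1 ≤ k) {A : Set (Site 2)}
    (hA : A ⊆ ((↑((trapDomain M).lower c z) : Set (Site 2))ᶜ ∩ ω)) {s t : Site 2}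
    (hs : z 0 - 3 * k ≤ s 0 ∧ s 0 ≤ z 0 + 3 * k ∧ z 1 - 3 * k ≤ s 1 ∧ s 1 ≤ z 1 + 3 * k)
    (ht : t 0 ≤ z 0 - 7 * k ∨ z 0 + 7 * k ≤ t 0 ∨ t 1 ≤ z 1 - 7 * k ∨ z 1 + 7 * k ≤ t 1) :
    ¬ PathIn triGraph A s t := fun hp => h.inner_ring hk hs ht (hp.mono hA)

end TrapRawOK

/-! ### Raw failure of a term and its probability -/

/-- **Raw failure of the `u`-th term**: the term exists and is raw-bad on all the scales
`k_j = k₀ · 32^j`, `j < K`. [cite: Nolin2008, §4.4 Lemma 15 (proof) (arXiv 0711.4948: Lemma 14)] -/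
def TrapSeqFailRaw (M u k₀ K : ℕ) (ω : SiteConfig (Site 2)) : Prop :=
  ∃ c z, (trapDomain M).lowestSeq ω u = some (c, z) ∧ ∀ j < K, ¬ TrapRawOK M c z (trapScale k₀ j) ω

/-- Raw failure is exactly `TrapNoRSW₃` for the term. [folklore] -/
theorem trapNoRSW₃_of_failRaw {M k₀ K : ℕ} {c : Finset (Site 2)} {z : Site 2} {ω : SiteConfig (Site 2)}
    (hfail : ∀ j < K, ¬ TrapRawOK M c z (trapScale k₀ j) ω) : TrapNoRSW₃ M c z k₀ K ω :=
  fun j hj ω' hagree hω' => hfail j hj ⟨ω', hagree, hω'⟩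

/-- **On the complement of raw failure every term is raw-good on some scale.** [folklore] -/
theorem exists_trapRawOK_of_not_failRaw {M u k₀ K : ℕ} {c : Finset (Site 2)} {z : Site 2}
    {ω : SiteConfig (Site 2)} (h : ¬ TrapSeqFailRaw M u k₀ K ω)
    (hu : (trapDomain M).lowestSeq ω u = some (c, z)) : ∃ j < K, TrapRawOK M c z (trapScale k₀ j) ω := by
  by_contra hno
  push Not at hno
  exact h ⟨c, z, hu, fun j hj => hno j hj⟩

/-- **Probability of raw failure of the `u`-th term at density `p`**:
`P_p(TrapSeqFailRaw) ≤ P_p(term u exists) · (1 - c_F² c_E c_I)^K` (decoupling on `lower c z` and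
`K` independent annuli; the proof of `real_trapSeqFail₃_le_at`). [cite: Nolin2008, §4.4 Lemma 15 (proof) (arXiv 0711.4948: Lemma 14)] [cite: Kesten1987, Lemma 2 (eq. (2.26))] -/
theorem real_trapSeqFailRaw_le_at (p : unitInterval) {cF cE cI : ℝ} (hcF : 0 < cF) (hcF1 : cF ≤ 1) (hcE : 0 ≤ cE)
    (hcE1 : cE ≤ 1) (hcI : 0 ≤ cI) (hcI1 : cI ≤ 1) {M : ℕ}
    (hF : ∀ (z : Site 2) (k : ℕ), 1 ≤ k → k < M → cF ≤ (triSitePercolation p).real (triFrameAt z k))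
    (hEr : ∀ (z : Site 2) (k : ℕ), 1 ≤ k → 32 * k < M → cE ≤ (triSitePercolation p).real (compl ⁻¹' triRingAt z k))
    (hIr : ∀ (z : Site 2) (k : ℕ), 1 ≤ k → 32 * k < M → cI ≤ (triSitePercolation p).real (compl ⁻¹' triInnerRingAt z k))
    {u k₀ K : ℕ} (hM : 1 ≤ M) (hk₀ : 1 ≤ k₀) (hKM : ∀ j < K, 32 * (trapScale k₀ j : ℤ) + 1 ≤ M) :
    (triSitePercolation p).real {ω | TrapSeqFailRaw M u k₀ K ω} ≤
      (triSitePercolation p).real {ω | (trapDomain M).lowestSeq ω u ≠ none} * (1 - cF ^ 2 * cE * cI) ^ K := by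
  classical
  have hcut := trapDomain_cutProp M
  have hdual := trapDomain_dualProp hM
  have hKS : ∀ j < K, 8 * trapScale k₀ j < M := fun j hj => by have := hKM j hj; omega
  have hKS' : ∀ j < K, trapScale k₀ j < (M - 1) / 32 + 1 := fun j hj => by have := hKM j hj; omega
  have hEr' : ∀ (z : Site 2) (k : ℕ), 1 ≤ k → k < (M - 1) / 32 + 1 → cE ≤ (triSitePercolation p).real (compl ⁻¹' triRingAt z k) :=
    fun z k hk hkS => hEr z k hk (by omega)
  have hIr' : ∀ (z : Site 2) (k : ℕ), 1 ≤ k → k < (M - 1) / 32 + 1 → cI ≤ (triSitePercolation p).real (compl ⁻¹' triInnerRingAt z k) :=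
    fun z k hk hkS => hIr z k hk (by omega)
  set μ := triSitePercolation p with hμ
  set E : Finset (Site 2) × Site 2 → Set (SiteConfig (Site 2)) :=
    fun q => {ω | (trapDomain M).lowestSeq ω u = some q} with hE
  have hsub : {ω | TrapSeqFailRaw M u k₀ K ω} ⊆ ⋃ q ∈ trapPairs M, (E q ∩ {ω | TrapNoRSW₃ M q.1 q.2 k₀ K ω}) := by
    rintro ω ⟨c, z, h, hfail⟩
    simp only [Set.mem_iUnion, Set.mem_inter_iff, Set.mem_setOf_eq]
    exact ⟨(c, z), mem_trapPairs_of_lowestSeq h, h, trapNoRSW₃_of_failRaw hfail⟩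
  have hterm : ∀ q ∈ trapPairs M, μ.real (E q ∩ {ω | TrapNoRSW₃ M q.1 q.2 k₀ K ω}) ≤ μ.real (E q) * (1 - cF ^ 2 * cE * cI) ^ K := by
    rintro ⟨c, z⟩ -
    have hEdet : DeterminedBy (E (c, z)) ↑((trapDomain M).lower c z) :=
      JDomain.determinedBy_lowestSeq_eq hcut hdual u c z
    have hNdet := determinedBy_trapNoRSW₃ M c z k₀ K
    have hdisj : Disjoint ((trapDomain M).lower c z) (trapScalesFinset₂ z k₀ K \ (trapDomain M).lower c z) :=
      Finset.disjoint_sdiff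
    rw [hμ]
    unfold triSitePercolation
    rw [sitePercolation_real_inter_of_disjoint p hEdet hNdet hdisj]
    refine mul_le_mul_of_nonneg_left ?_ measureReal_nonneg
    have h1 := (real_iInter_compl_trapRSW₃_le_at p hcF hcE hcI hF hEr' hIr' z hk₀ K hKS hKS').1
    unfold triSitePercolation at h1
    exact (measureReal_mono (trapNoRSW₃_subset M c z k₀ K)).trans h1
  have hmeas : ∀ q ∈ trapPairs M, MeasurableSet (E q) := fun q _ =>
    (JDomain.determinedBy_lowestSeq_eq hcut hdual u q.1 q.2).measurableSet_of_finset
  have hdisjE : (↑(trapPairs M) : Set (Finset (Site 2) × Site 2)).PairwiseDisjoint E := fun q _ q' _ hqq' =>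
    JDomain.disjoint_setOf_lowestSeq_eq hqq'
  have hunion : μ.real (⋃ q ∈ trapPairs M, E q) ≤ μ.real {ω | (trapDomain M).lowestSeq ω u ≠ none} := by
    refine measureReal_mono ?_
    intro ω hω
    simp only [Set.mem_iUnion, Set.mem_setOf_eq] at hω ⊢
    obtain ⟨q, -, hq⟩ := hω
    rw [hq]; exact Option.some_ne_none q
  have h0 : 0 ≤ 1 - cF ^ 2 * cE * cI := by
    have h1 : cF ^ 2 ≤ 1 := pow_le_one₀ hcF.le hcF1
    have h2 : cF ^ 2 * cE * cI ≤ 1 := by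
      calc cF ^ 2 * cE * cI ≤ 1 * 1 * 1 := by gcongr
        _ = 1 := by ring
    linarith
  calc μ.real {ω | TrapSeqFailRaw M u k₀ K ω}
      ≤ μ.real (⋃ q ∈ trapPairs M, (E q ∩ {ω | TrapNoRSW₃ M q.1 q.2 k₀ K ω})) :=
        measureReal_mono hsub (measure_ne_top _ _)
    _ ≤ ∑ q ∈ trapPairs M, μ.real (E q ∩ {ω | TrapNoRSW₃ M q.1 q.2 k₀ K ω}) := measureReal_biUnion_finset_le _ _
    _ ≤ ∑ q ∈ trapPairs M, μ.real (E q) * (1 - cF ^ 2 * cE * cI) ^ K := Finset.sum_le_sum hterm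
    _ = (∑ q ∈ trapPairs M, μ.real (E q)) * (1 - cF ^ 2 * cE * cI) ^ K := (Finset.sum_mul _ _ _).symm
    _ = μ.real (⋃ q ∈ trapPairs M, E q) * (1 - cF ^ 2 * cE * cI) ^ K := by rw [measureReal_biUnion_finset hdisjE hmeas]
    _ ≤ μ.real {ω | (trapDomain M).lowestSeq ω u ≠ none} * (1 - cF ^ 2 * cE * cI) ^ K :=
        mul_le_mul_of_nonneg_right hunion (pow_nonneg h0 K)

/-- `{TrapSeqFailRaw}` is determined by the trapezoid together with the wide annuli of the scales
(a finite set), hence measurable. [folklore] -/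
theorem measurableSet_trapSeqFailRaw (M u k₀ K : ℕ) (hM : 1 ≤ M) :
    MeasurableSet {ω : SiteConfig (Site 2) | TrapSeqFailRaw M u k₀ K ω} := by
  classical
  have hcut := trapDomain_cutProp M
  have hdual := trapDomain_dualProp hM
  have heq : {ω : SiteConfig (Site 2) | TrapSeqFailRaw M u k₀ K ω} =
      ⋃ q ∈ trapPairs M, ({ω | (trapDomain M).lowestSeq ω u = some q} ∩ {ω | TrapNoRSW₃ M q.1 q.2 k₀ K ω}) := by
    ext ω
    simp only [Set.mem_setOf_eq, Set.mem_iUnion, Set.mem_inter_iff, exists_prop]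
    constructor
    · rintro ⟨c, z, h, hfail⟩
      exact ⟨(c, z), mem_trapPairs_of_lowestSeq h, h, trapNoRSW₃_of_failRaw hfail⟩
    · rintro ⟨⟨c, z⟩, -, h, hno⟩
      exact ⟨c, z, h, fun j hj ⟨ω', hagree, hω'⟩ => hno j hj ω' hagree hω'⟩
  rw [heq]
  refine MeasurableSet.biUnion (Finset.countable_toSet _) fun q _ => ?_
  exact ((JDomain.determinedBy_lowestSeq_eq hcut hdual u q.1 q.2).measurableSet_of_finset).inter
    (determinedBy_trapNoRSW₃ M q.1 q.2 k₀ K).measurableSet_of_finset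

end Literature.Probability.Percolation
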